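import Summits.QuantumFields.YangMills.Theorems.ContractibleFibreFibreToTorusEnergyUniqueDensity
import Summits.QuantumFields.YangMills.Theorems.ContractibleFibreFibreToTorusEnergyConvexity
import Summits.QuantumFields.YangMills.Theorems.ContractibleFibreFibreToTorusInvariantDLRExists
import Summits.QuantumFields.YangMills.Theorems.ContractibleFibreFibreToTorusTubeInvariance
import Summits.QuantumFields.YangMills.Theorems.ContractibleFibreFibreToTorusTubeLimitStrong
import Summits.QuantumFields.YangMills.Theorems.ContractibleFibreFibreToTorusKinkSubseq
import Summits.QuantumFields.YangMills.Theorems.ContractibleFibreFibreToTorusKinkDLRLimit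
import Summits.QuantumFields.YangMills.Theorems.ContractibleFibreFibreToTorusKinkSlopes
import HarnessLib

/-!
# A kink of the pressure forces energy coexistence; differentiability of the pressure ⇔ one action density

Helper file of crux `FibreToTorus` (stmt-QuantumFields-16244), line `Sketch` (energy programme, converse direction; card
`film-transition-sieve` statements `KinkEnergyCoexistence` / `EnergyCoexistenceKink`).  For the Wilson lattice gauge theory of
a compact Hausdorff second-countable group in a continuous matrix representation `ρ` on `ℤ^d` with torus pressure
`f = freeEnergyDensity d ρ`:

* `kink_energyCoexistence` — if `f` is NOT differentiable at `β`, there are two translation-invariant DLR states at `β` with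
  different mean action densities (Friedli–Velenik 2017, Prop. 6.91 (6.118) / Thm. 6.92): translation-invariant DLR states at
  couplings `β ∓ 1/(k+1)` exist (`kink_exists_translationInvariant_ymGibbsMeasure`); by the chord inequality
  `energy_pressure_chord` at those couplings and the separated one-sided slopes of the convex `f` at the kink
  (`energy_convexOn_freeEnergyDensity`, `kink_convex_separated_slopes`) their energies are `≥ -∂⁻f(β)` resp. `≤ -∂⁺f(β)`;
  weak subsequential limits exist (`kink_exists_subseq_weakLimit`), are DLR at `β` (`kink_mem_ymGibbsMeasures_of_tendsto_coupling`),
  translation invariant (`map_eq_of_tendsto_of_map_eq`), and inherit the energy bounds (the energy is an integral of bounded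
  continuous plaquette observables).
* `kink_differentiableAt_iff_uniqueActionDensity` — hence `f` is differentiable at `β` iff all translation-invariant DLR states at
  `β` have the same mean action density (→ is E6 `energy_actionDensity_eq_of_differentiableAt`): the ENERGY SECTOR of the open
  stub PTU / U_tr of line `Sketch` is EXACTLY differentiability of the pressure.
-/

noncomputable section

open MeasureTheory Filter Topology Finset
open Literature.Probability.LatticeModels (Site IsGibbsMeasure)
open Literature.MathematicalPhysics.QuantumLattice (LGConfig ZdEdge ymGibbsMeasures ymSpecification IsZdTranslationInvariant
  freeEnergyDensity configShift plaquetteObs continuous_plaquetteObs integrable_of_bound)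
open Literature.MathematicalPhysics.QuantumFieldTheory (exists_bound_trace_re_nonneg)

namespace Summit.QuantumFields.YangMills.Theorems.FibreToTorus

/-- **A kink of the pressure forces energy coexistence** (registered helper sub-goal `kink_energyCoexistence`): if the
torus pressure is not differentiable at `β`, two translation-invariant DLR states at `β` have different mean action densities.
[cite: FriedliVelenik2017, Prop. 6.91 (6.118)] -/
theorem kink_energyCoexistence : ∀ (d N : ℕ) (G : Type) [Group G] [TopologicalSpace G] [IsTopologicalGroup G] [CompactSpace G] [MeasurableSpace G] [BorelSpace G] [T2Space G] [SecondCountableTopology G] (ρ : G →* Matrix (Fin N) (Fin N) ℂ), Continuous ρ → ∀ β : ℝ, ¬ DifferentiableAt ℝ (freeEnergyDensity d ρ) β → ∃ μ ν : MeasureTheory.Measure (LGConfig d G), μ ∈ ymGibbsMeasures (d := d) ρ β ∧ ν ∈ ymGibbsMeasures (d := d) ρ β ∧ IsZdTranslationInvariant μ ∧ IsZdTranslationInvariant ν ∧ ∑ q : {q : Fin d × Fin d // q.1 < q.2}, ∫ U, plaquetteObs ρ 0 q.1.1 q.1.2 U ∂μ < ∑ q : {q : Fin d × Fin d // q.1 <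 q.2}, ∫ U, plaquetteObs ρ 0 q.1.1 q.1.2 U ∂ν := by
  have hG2 := kink_mem_ymGibbsMeasures_of_tendsto_coupling
  have hG3 := kink_exists_subseq_weakLimit
  have hG4 := kink_convex_separated_slopes
  intro d N G _ _ _ _ _ _ _ _ ρ hρ β hnd
  classical
  obtain ⟨M, hM0, hM⟩ := exists_bound_trace_re_nonneg ρ hρ
  -- the plaquette sum of a measure and the action density `e κ = D N - plaq κ`
  let plaq : Measure (LGConfig d G) → ℝ := fun κ =>
    ∑ q : {q : Fin d × Fin d // q.1 < q.2}, ∫ U, plaquetteObs ρ 0 q.1.1 q.1.2 U ∂κ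
  let e : Measure (LGConfig d G) → ℝ := fun κ =>
    ∑ q : {q : Fin d × Fin d // q.1 < q.2}, ((N : ℝ) - ∫ U, plaquetteObs ρ 0 q.1.1 q.1.2 U ∂κ)
  have he : ∀ κ, e κ = (Fintype.card {q : Fin d × Fin d // q.1 < q.2} : ℝ) * N - plaq κ := fun κ => by
    simp only [e, plaq, Finset.sum_sub_distrib, Finset.sum_const, Finset.card_univ, nsmul_eq_mul]
  -- separated one-sided slopes of the convex pressure at the kink
  set f : ℝ → ℝ := freeEnergyDensity d ρ with hf
  obtain ⟨s₁, s₂, hs, hleft, hright⟩ := hG4 f β (energy_convexOn_freeEnergyDensity d N G ρ hρ) hnd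
  -- extraction of a translation-invariant DLR limit state along couplings `βs k → β`, with its energy a limit
  have extract : ∀ βs : ℕ → ℝ, Tendsto βs atTop (𝓝 β) →
      ∃ (μs : ℕ → Measure (LGConfig d G)) (φ : ℕ → ℕ) (μ : Measure (LGConfig d G)),
        (∀ k, μs k ∈ ymGibbsMeasures (d := d) ρ (βs k) ∧ IsZdTranslationInvariant (μs k)) ∧
        StrictMono φ ∧ μ ∈ ymGibbsMeasures (d := d) ρ β ∧ IsZdTranslationInvariant μ ∧
        Tendsto (fun k => e (μs (φ k))) atTop (𝓝 (e μ)) := by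
    intro βs hβs
    choose μs hμs using fun k => kink_exists_translationInvariant_ymGibbsMeasure d N G ρ hρ (βs k)
    haveI hprob : ∀ k, IsProbabilityMeasure (μs k) := fun k => (hμs k).2.1
    obtain ⟨φ, μ, hφ, hμP, hlim⟩ := hG3 d G μs hprob
    haveI := hμP
    refine ⟨μs, φ, μ, fun k => ⟨(hμs k).1, (hμs k).2.2⟩, hφ, ?_, ?_, ?_⟩
    · -- DLR at the limit coupling (G2)
      exact hG2 d N G ρ hρ (fun k => βs (φ k)) β (hβs.comp hφ.tendsto_atTop) (fun k => μs (φ k)) μ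
        (fun k => (hμs (φ k)).1) hμP hlim
    · -- translation invariance passes to the limit
      intro v
      haveI : ∀ k, IsProbabilityMeasure ((fun k => μs (φ k)) k) := fun k => hprob (φ k)
      exact map_eq_of_tendsto_of_map_eq (fun k => μs (φ k)) μ
        (Literature.MathematicalPhysics.QuantumFieldTheory.continuous_configShift (G := G) v)
        (configShift v).measurable (fun k => (hμs (φ k)).2.2 v) hlim
    · -- the energy is an integral of bounded continuous functions
      have hq : ∀ q : {q : Fin d × Fin d // q.1 < q.2},
          Tendsto (fun k => ∫ U, plaquetteObs ρ 0 q.1.1 q.1.2 U ∂μs (φ k)) atTop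
            (𝓝 (∫ U, plaquetteObs ρ 0 q.1.1 q.1.2 U ∂μ)) := fun q =>
        hlim _ (continuous_plaquetteObs ρ hρ 0 q.1.1 q.1.2) ⟨M, fun U => by unfold plaquetteObs; exact hM _⟩
      have hsum : Tendsto (fun k => e (μs (φ k))) atTop
          (𝓝 (∑ q : {q : Fin d × Fin d // q.1 < q.2}, ((N : ℝ) - ∫ U, plaquetteObs ρ 0 q.1.1 q.1.2 U ∂μ))) :=
        tendsto_finsetSum _ fun q _ => tendsto_const_nhds.sub (hq q)
      exact hsum
  -- BELOW the kink: `β_k = β - 1/(k+1)`, energies `≥ -s₁`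
  have hβlow : Tendsto (fun k : ℕ => β - 1 / ((k : ℝ) + 1)) atTop (𝓝 β) := by
    have h := tendsto_const_nhds (x := β) |>.sub (tendsto_one_div_add_atTop_nhds_zero_nat)
    rwa [sub_zero] at h
  obtain ⟨μs, φ, μ, hμs, hφ, hμG, hμT, hμe⟩ := extract _ hβlow
  have hμs_e : ∀ k, -s₁ ≤ e (μs k) := by
    intro k
    have hδ : (0 : ℝ) < 1 / ((k : ℝ) + 1) := by positivity
    have hchord := energy_pressure_chord ρ hρ β (hμs k).1 (hμs k).2
    -- `f(β_k) - (β - β_k) e_k ≤ f(β)` and `f β - f β_k ≤ s₁ (β - β_k)`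
    have hsl := hleft (β - 1 / ((k : ℝ) + 1)) (by linarith)
    have h1 : β - (β - 1 / ((k : ℝ) + 1)) = 1 / ((k : ℝ) + 1) := by ring
    rw [h1] at hchord hsl
    have : -(s₁ * (1 / ((k : ℝ) + 1))) ≤ 1 / ((k : ℝ) + 1) * e (μs k) := by
      show -(s₁ * (1 / ((k : ℝ) + 1))) ≤ 1 / ((k : ℝ) + 1) *
        ∑ q : {q : Fin d × Fin d // q.1 < q.2}, ((N : ℝ) - ∫ U, plaquetteObs ρ 0 q.1.1 q.1.2 U ∂μs k)
      linarith
    by_contra hlt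
    have hlt' : e (μs k) < -s₁ := lt_of_not_ge hlt
    have : 1 / ((k : ℝ) + 1) * e (μs k) < 1 / ((k : ℝ) + 1) * (-s₁) := mul_lt_mul_of_pos_left hlt' hδ
    linarith
  have hμ_e : -s₁ ≤ e μ := ge_of_tendsto hμe (Eventually.of_forall fun k => hμs_e (φ k))
  -- ABOVE the kink: `β_k = β + 1/(k+1)`, energies `≤ -s₂`
  have hβup : Tendsto (fun k : ℕ => β + 1 / ((k : ℝ) + 1)) atTop (𝓝 β) := by
    have h := tendsto_const_nhds (x := β) |>.add (tendsto_one_div_add_atTop_nhds_zero_nat)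
    rwa [add_zero] at h
  obtain ⟨νs, ψ, ν, hνs, hψ, hνG, hνT, hνe⟩ := extract _ hβup
  have hνs_e : ∀ k, e (νs k) ≤ -s₂ := by
    intro k
    have hδ : (0 : ℝ) < 1 / ((k : ℝ) + 1) := by positivity
    have hchord := energy_pressure_chord ρ hρ β (hνs k).1 (hνs k).2
    have hsr := hright (β + 1 / ((k : ℝ) + 1)) (by linarith)
    have h1 : β - (β + 1 / ((k : ℝ) + 1)) = -(1 / ((k : ℝ) + 1)) := by ring
    have h2 : β + 1 / ((k : ℝ) + 1) - β = 1 / ((k : ℝ) + 1) := by ring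
    rw [h1] at hchord
    rw [h2] at hsr
    have : s₂ * (1 / ((k : ℝ) + 1)) ≤ -(1 / ((k : ℝ) + 1)) * e (νs k) := by
      show s₂ * (1 / ((k : ℝ) + 1)) ≤ -(1 / ((k : ℝ) + 1)) *
        ∑ q : {q : Fin d × Fin d // q.1 < q.2}, ((N : ℝ) - ∫ U, plaquetteObs ρ 0 q.1.1 q.1.2 U ∂νs k)
      linarith
    by_contra hlt
    have hlt' : -s₂ < e (νs k) := lt_of_not_ge hlt
    have : 1 / ((k : ℝ) + 1) * (-s₂) < 1 / ((k : ℝ) + 1) * e (νs k) := mul_lt_mul_of_pos_left hlt' hδ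
    linarith
  have hν_e : e ν ≤ -s₂ := le_of_tendsto hνe (Eventually.of_forall fun k => hνs_e (ψ k))
  -- conclude: `e ν < e μ`, i.e. `plaq μ < plaq ν`
  refine ⟨μ, ν, hμG, hνG, hμT, hνT, ?_⟩
  have hlt : e ν < e μ := by linarith
  rw [he, he] at hlt
  show plaq μ < plaq ν
  linarith

/-- **Differentiability of the pressure ⇔ one action density among translation-invariant Gibbs states** (registered helper
sub-goal `kink_differentiableAt_iff_uniqueActionDensity`; Friedli–Velenik 2017, Thm. 6.92 shape for lattice gauge theory):
the torus pressure `freeEnergyDensity d ρ` is differentiable at `β` iff any two translation-invariant DLR states of the Wilson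
specification at `β` have the same plaquette expectation summed over planes (equivalently the same mean action density).
[cite: FriedliVelenik2017, Thm. 6.92] -/
theorem kink_differentiableAt_iff_uniqueActionDensity : ∀ (d N : ℕ) (G : Type) [Group G] [TopologicalSpace G] [IsTopologicalGroup G] [CompactSpace G] [MeasurableSpace G] [BorelSpace G] [T2Space G] [SecondCountableTopology G] (ρ : G →* Matrix (Fin N) (Fin N) ℂ), Continuous ρ → ∀ β : ℝ, DifferentiableAt ℝ (freeEnergyDensity d ρ) β ↔ ∀ μ ν : MeasureTheory.Measure (LGConfig d G), μ ∈ ymGibbsMeasures (d := d) ρ β → ν ∈ ymGibbsMeasures (d := d) ρ β → IsZdTranslationInvariant μ → IsZdTranslationInvariant ν → ∑ q : {q : Fin d × Fin d // q.1 < q.2}, ∫ U, plaquetteObs ρ 0 q.1.1 q.1.2 U ∂μ = ∑ q : {q : Fin d × Fin d // q.1 < q.2}, ∫ U, plaquetteObs ρ 0 q.1.1 q.1.2 U ∂ν := by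
  intro d N G _ _ _ _ _ _ _ _ ρ hρ β
  constructor
  · intro hdiff μ ν hμ hν hμT hνT
    exact energy_actionDensity_eq_of_differentiableAt ρ hρ hdiff hμ hν hμT hνT
  · intro h
    by_contra hnd
    obtain ⟨μ, ν, hμ, hν, hμT, hνT, hlt⟩ := kink_energyCoexistence d N G ρ hρ β hnd
    exact (ne_of_lt hlt) (h μ ν hμ hν hμT hνT)

end Summit.QuantumFields.YangMills.Theorems.FibreToTorus

end
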